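import Literature.Geometry.Riemannian.ChartMeasureComparison
import Literature.Geometry.Riemannian.LipschitzSmoothing
import HarnessLib

/-!
# Chart representatives of functions supported in a chart domain: regularity, derivative and
# `Lᵖ` bounds (transfer tools for integral inequalities on closed manifolds)

Continuation of `ChartMeasureComparison.lean`. For a smooth Riemannian `g` on a manifold `M`
modelled on a finite-dimensional normed space `E` (boundaryless), a chart `φ = extChartAt I x₀`,
and a function `u : M → ℝ` supported in the chart domain, the **zero extension of the chart
representative** `v = 𝟙_{φ.target} · (u ∘ φ⁻¹) : E → ℝ` satisfies:

* `indicator_comp_symm_apply` — `v = u ∘ φ⁻¹` on `φ.target`, `v = 0` off `φ(tsupport u)`;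
* `contDiff_indicator_comp_symm` — `v ∈ C¹_c(E)` if `u ∈ C¹(M)` has compact support in the chart
  domain;
* `norm_fderiv_indicator_comp_symm_le` — `‖Dv(φ q)‖ ≤ C |∇u|_g(q)` on a set `U` where
  `|D(φ⁻¹)_{φ q} w|_g ≤ C‖w‖` (chain rule and Cauchy–Schwarz for `g`);
* `eLpNorm_le_and_le_of_biLipschitz` — for `U` a bi-Lipschitz chart neighbourhood
  (`exists_isOpen_biLipschitz_extChartAt`), `f` measurable with `support f ⊆ U` and `0 < p < ∞`:
  `‖f‖_{Lᵖ(Vol_g)} ≤ C^{n/p} ‖v‖_{Lᵖ(μHE[n])}` and `‖v‖_{Lᵖ(μHE[n])} ≤ C^{n/p} ‖f‖_{Lᵖ(Vol_g)}`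
  (from `lintegral_le_and_le_of_biLipschitz`).

These are the ingredients for transporting Mathlib's Euclidean Gagliardo–Nirenberg–Sobolev
inequality to closed manifolds (`SobolevClosedManifold.lean`). Everything is proved; no
definitions, no named facts.

## References

* H. Federer, *Geometric Measure Theory*, Springer 1969, §2.10.11. [Federer1969]
* E. Hebey, *Nonlinear analysis on manifolds: Sobolev spaces and inequalities*, Courant Lecture
  Notes 5, 1999, §2.2 (Sobolev embeddings on compact manifolds via charts and partitions of unity).
-/

noncomputable section

open Bundle Set Function Filter Manifold MeasureTheory Metric Module
open scoped Manifold ContDiff Topology ENNReal NNReal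

namespace Literature.Geometry.Riemannian

open Lorentzian

section ZeroExtension

variable {E : Type*} [NormedAddCommGroup E] [NormedSpace ℝ E] [FiniteDimensional ℝ E]
  {H : Type*} [TopologicalSpace H] {I : ModelWithCorners ℝ E H} [I.Boundaryless]
  {M : Type*} [TopologicalSpace M] [ChartedSpace H M] [IsManifold I ∞ M]
  (g : PseudoRiemannianMetric I ∞ E (TangentSpace I : M → Type _))

omit [FiniteDimensional ℝ E] [I.Boundaryless] [IsManifold I ∞ M] in
/-- **The zero extension of a chart representative** `v = 𝟙_{φ.target} · (u ∘ φ⁻¹)` of a function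
`u` supported in the chart domain agrees with `u ∘ φ⁻¹` on the target and vanishes off the image
of the support. [folklore] -/
theorem indicator_comp_symm_apply (x₀ : M) (u : M → ℝ) :
    (∀ y ∈ (extChartAt I x₀).target,
      (extChartAt I x₀).target.indicator (u ∘ (extChartAt I x₀).symm) y = u ((extChartAt I x₀).symm y)) ∧
    ∀ y, y ∉ extChartAt I x₀ '' tsupport u →
      (extChartAt I x₀).target.indicator (u ∘ (extChartAt I x₀).symm) y = 0 := by
  refine ⟨fun y hy ↦ by rw [indicator_of_mem hy]; rfl, fun y hy ↦ ?_⟩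
  by_cases hyt : y ∈ (extChartAt I x₀).target
  · rw [indicator_of_mem hyt, Function.comp_apply]
    refine image_eq_zero_of_notMem_tsupport (fun h ↦ hy ?_)
    exact ⟨_, h, (extChartAt I x₀).right_inv hyt⟩
  · exact indicator_of_notMem hyt _

omit [FiniteDimensional ℝ E] in
/-- **The zero extension of a chart representative is `C¹` with compact support** when `u ∈ C¹`
has compact support inside the chart domain (`contDiff_of_contDiffOn_of_eq_zero`). [folklore] -/
theorem contDiff_indicator_comp_symm (x₀ : M) {u : M → ℝ} (hu : ContMDiff I 𝓘(ℝ, ℝ) 1 u)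
    (hK : IsCompact (tsupport u)) (hKs : tsupport u ⊆ (chartAt H x₀).source) :
    ContDiff ℝ 1 ((extChartAt I x₀).target.indicator (u ∘ (extChartAt I x₀).symm)) ∧
      HasCompactSupport ((extChartAt I x₀).target.indicator (u ∘ (extChartAt I x₀).symm)) := by
  set φ := extChartAt I x₀ with hφ
  have hKs' : tsupport u ⊆ φ.source := by rwa [hφ, extChartAt_source]
  have hKc : IsCompact (φ '' tsupport u) :=
    hK.image_of_continuousOn ((continuousOn_extChartAt x₀).mono hKs')
  have hKt : φ '' tsupport u ⊆ φ.target := by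
    rintro _ ⟨q, hq, rfl⟩; exact φ.map_source (hKs' hq)
  obtain ⟨hon, hoff⟩ := indicator_comp_symm_apply (I := I) x₀ u
  have hcd : ContDiffOn ℝ 1 (φ.target.indicator (u ∘ φ.symm)) φ.target :=
    (contDiffOn_comp_extChartAt_symm hu).congr (fun y hy ↦ hon y hy)
  exact ⟨contDiff_of_contDiffOn_of_eq_zero (isOpen_extChartAt_target x₀) hKc hKt hcd hoff,
    HasCompactSupport.intro hKc hoff⟩

set_option backward.isDefEq.respectTransparency false in
/-- **Derivative of the zero extension**: on `U` (in the chart domain) where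
`|D(φ⁻¹)_{φ q} w|_g ≤ C ‖w‖`, the chart representative of `u ∈ C¹` satisfies
`‖D v(φ q)‖ ≤ C |∇u|_g(q)` (`v = 𝟙_{target} · u ∘ φ⁻¹`; chain rule and Cauchy–Schwarz
`|du(ξ)| ≤ |∇u|_g |ξ|_g`). [folklore] -/
theorem norm_fderiv_indicator_comp_symm_le (hg : g.IsRiemannian) (x₀ : M) {u : M → ℝ}
    (hu : ContMDiff I 𝓘(ℝ, ℝ) 1 u) {U : Set M} (hUs : U ⊆ (chartAt H x₀).source) {C : ℝ} (hC : 0 ≤ C)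
    (hD : ∀ q ∈ U, ∀ w : E, g.val q
        (mfderivWithin 𝓘(ℝ, E) I (extChartAt I x₀).symm (range I) (extChartAt I x₀ q) w)
        (mfderivWithin 𝓘(ℝ, E) I (extChartAt I x₀).symm (range I) (extChartAt I x₀ q) w) ≤
      C ^ 2 * ‖w‖ ^ 2) {q : M} (hq : q ∈ U) :
    ‖fderiv ℝ ((extChartAt I x₀).target.indicator (u ∘ (extChartAt I x₀).symm)) (extChartAt I x₀ q)‖
      ≤ C * Real.sqrt (g.gradSq u q) := by
  set φ := extChartAt I x₀ with hφ
  have hqs : q ∈ φ.source := by rw [hφ, extChartAt_source]; exact hUs hq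
  have hqt : φ q ∈ φ.target := φ.map_source hqs
  -- near `φ q`, `v = u ∘ φ⁻¹`
  have hev : φ.target.indicator (u ∘ φ.symm) =ᶠ[𝓝 (φ q)] u ∘ φ.symm := by
    filter_upwards [(isOpen_extChartAt_target x₀).mem_nhds hqt] with y hy
    exact indicator_of_mem hy _
  rw [hev.fderiv_eq]
  refine ContinuousLinearMap.opNorm_le_bound _ (by positivity) (fun w ↦ ?_)
  have hud : MDifferentiableAt I 𝓘(ℝ, ℝ) u q := (hu q).mdifferentiableAt (by simp)
  have hkey := mvfderiv_apply_mfderivWithin_symm (I := I) (hUs hq) hud w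
  rw [Real.norm_eq_abs, ← hkey]
  refine (abs_mvfderiv_le_sqrt_gradSq_mul_sqrt g hg u q _).trans ?_
  rw [mul_comm C, mul_assoc]
  gcongr
  calc Real.sqrt _ ≤ Real.sqrt (C ^ 2 * ‖w‖ ^ 2) := Real.sqrt_le_sqrt (hD q hq w)
    _ = C * ‖w‖ := by rw [← mul_pow, Real.sqrt_sq (by positivity)]

end ZeroExtension


/-! ### `Lᵖ` norms under a bi-Lipschitz chart -/

section LpTransfer

variable {E : Type*} [NormedAddCommGroup E] [NormedSpace ℝ E] [FiniteDimensional ℝ E]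
  [MeasurableSpace E] [BorelSpace E]
  {H : Type*} [TopologicalSpace H] {I : ModelWithCorners ℝ E H} [I.Boundaryless]
  {M : Type*} [TopologicalSpace M] [ChartedSpace H M] [IsManifold I ∞ M] [T3Space M]
  [MeasurableSpace M] [BorelSpace M]
  (g : PseudoRiemannianMetric I ∞ E (TangentSpace I : M → Type _))

/-- **`Lᵖ` norms of a function supported in a bi-Lipschitz chart domain vs. those of its chart
representative**: with `U`, `C` as in `lintegral_le_and_le_of_biLipschitz`, `f` measurable with
`support f ⊆ U`, `v = 𝟙_{φ.target} · f ∘ φ⁻¹` and `0 < p < ∞`: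
`‖f‖_{Lᵖ(Vol_g)} ≤ C^{n/p} ‖v‖_{Lᵖ(μHE[n])}` and `‖v‖_{Lᵖ(μHE[n])} ≤ C^{n/p} ‖f‖_{Lᵖ(Vol_g)}`.
[cite: Federer1969, §2.10.11] -/
theorem eLpNorm_le_and_le_of_biLipschitz (hg : g.IsRiemannian) (x₀ : M) {U : Set M}
    (hUo : IsOpen U) (hUs : U ⊆ (chartAt H x₀).source) {C : ℝ≥0}
    (hup : ∀ q ∈ U, ∀ q' ∈ U, g.edist hg q q' ≤ C * edist (extChartAt I x₀ q) (extChartAt I x₀ q'))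
    (hlow : ∀ q ∈ U, ∀ q' ∈ U, edist (extChartAt I x₀ q) (extChartAt I x₀ q') ≤ C * g.edist hg q q')
    {f : M → ℝ} (hfm : Measurable f) (hsupp : support f ⊆ U) {p : ℝ≥0} (hp : 0 < p) :
    eLpNorm f p g.riemVolume ≤ (C : ℝ≥0∞) ^ ((finrank ℝ E : ℝ) / p) *
        eLpNorm ((extChartAt I x₀).target.indicator (f ∘ (extChartAt I x₀).symm)) p
          (μHE[finrank ℝ E] : Measure E) ∧
      eLpNorm ((extChartAt I x₀).target.indicator (f ∘ (extChartAt I x₀).symm)) p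
          (μHE[finrank ℝ E] : Measure E) ≤
        (C : ℝ≥0∞) ^ ((finrank ℝ E : ℝ) / p) * eLpNorm f p g.riemVolume := by
  set φ := extChartAt I x₀ with hφ
  set n := finrank ℝ E with hn
  set μE : Measure E := μHE[n] with hμE
  set v : E → ℝ := φ.target.indicator (f ∘ φ.symm) with hv
  have hUs' : U ⊆ φ.source := by rwa [hφ, extChartAt_source]
  have hp0 : (p : ℝ≥0∞) ≠ 0 := by exact_mod_cast hp.ne'
  have hpr : 0 < (p : ℝ) := hp
  -- the integrands `‖f‖ₑ^p` on `M` and `‖v‖ₑ^p` on `E`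
  set F : M → ℝ≥0∞ := fun x ↦ ‖f x‖ₑ ^ (p : ℝ) with hF
  have hFm : Measurable F := hfm.enorm.pow_const _
  have hFsupp : support F ⊆ U := by
    intro x hx
    by_contra hxU
    have : f x = 0 := by
      by_contra h; exact hxU (hsupp h)
    exact hx (by simp [hF, this, hpr])
  have hF_int : ∫⁻ x, F x ∂g.riemVolume = ∫⁻ x in U, F x ∂g.riemVolume :=
    (setLIntegral_eq_of_support_subset hFsupp).symm
  have hV_int : ∫⁻ y, ‖v y‖ₑ ^ (p : ℝ) ∂μE = ∫⁻ y in φ '' U, F (φ.symm y) ∂μE := by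
    have hVsupp : support (fun y ↦ ‖v y‖ₑ ^ (p : ℝ)) ⊆ φ '' U := by
      intro y hy
      have hvy : v y ≠ 0 := by
        intro h; exact hy (by simp [h, hpr])
      have hyt : y ∈ φ.target := by
        by_contra h; exact hvy (indicator_of_notMem h _)
      have hfy : f (φ.symm y) ≠ 0 := by
        rwa [hv, indicator_of_mem hyt, Function.comp_apply] at hvy
      exact ⟨φ.symm y, hsupp hfy, φ.right_inv hyt⟩
    rw [← setLIntegral_eq_of_support_subset hVsupp]
    refine setLIntegral_congr_fun ?_ (fun y hy ↦ ?_)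
    · rw [φ.image_eq_target_inter_inv_preimage hUs']
      exact ((continuousOn_extChartAt_symm x₀).isOpen_inter_preimage
        (isOpen_extChartAt_target x₀) hUo).measurableSet
    · obtain ⟨q, hq, rfl⟩ := hy
      simp only [hF, hv, indicator_of_mem (φ.map_source (hUs' hq)), Function.comp_apply]
  obtain ⟨h1, h2⟩ := lintegral_le_and_le_of_biLipschitz g hg x₀ hUo hUs hup hlow hFm
  -- `p`-th roots
  have hroot : ∀ {a b : ℝ≥0∞}, a ≤ (C : ℝ≥0∞) ^ n * b →
      a ^ (1 / (p : ℝ)) ≤ (C : ℝ≥0∞) ^ ((n : ℝ) / p) * b ^ (1 / (p : ℝ)) := by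
    intro a b hab
    calc a ^ (1 / (p : ℝ)) ≤ ((C : ℝ≥0∞) ^ n * b) ^ (1 / (p : ℝ)) :=
          ENNReal.rpow_le_rpow hab (by positivity)
      _ = (C : ℝ≥0∞) ^ ((n : ℝ) / p) * b ^ (1 / (p : ℝ)) := by
          rw [ENNReal.mul_rpow_of_nonneg _ _ (by positivity), ← ENNReal.rpow_natCast,
            ← ENNReal.rpow_mul]
          congr 2
          field_simp
  rw [eLpNorm_eq_lintegral_rpow_enorm_toReal hp0 ENNReal.coe_ne_top,
    eLpNorm_eq_lintegral_rpow_enorm_toReal hp0 ENNReal.coe_ne_top, ENNReal.coe_toReal, hF_int, hV_int]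
  exact ⟨hroot h1, hroot h2⟩

end LpTransfer

end Literature.Geometry.Riemannian

end
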